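import Mathlib

/-!
# `MatrixDescartes` census — WINDOW-4 POCKET ROWS III: the double-root curve in the parameter `t`, monotonicity of `H1`, `H2`

HONEST FRAMING.  Object-search cell `pub-symmetroid`, door-A target `DoorA26 := PosRootLawAt 2 6 19`
(stmt-ValiantsHypothesis-19979; OPEN, typed, never asserted).  Necessary-condition rows about the four-term WINDOWS of HYPOTHETICAL
Descartes-sharp fewnomials; nothing here bounds any census count, kills any cell or bears on `MatrixDescartes`
(stmt-ValiantsHypothesis-18050) / `VP ≠ VNP`.

Pure real analysis, no polynomial roots.  Along the curve of alternating 4-nomials `a − bX^u + cX^(u+v) − eX^(u+v+w)` with a positive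
DOUBLE root `ρ`, put `t = e·ρ^S/a` (`S = u+v+w`; in the normal form `a = e = 1` this is `t = ρ^S`, RATIONAL for rational `ρ`).  The two
circuit quantities are then `Σ1 := b^(u+v)/(a^v c^u) = H1(t) := ((u+v)+w·t)^(u+v)/(v^v (u+(v+w)t)^u)` and
`Σ2 := c^(v+w)/(b^w e^v) = H2(t) := (u+(v+w)t)^(v+w)/(v^v ((u+v)+w·t)^w t^v)`.  Both `log H1` and `log H2` have `t`-derivative
`v·(w(v+w)t − u(u+v))/(positive)`: strictly decreasing on the LOWER branch `t ≤ t* := u(u+v)/(w(v+w))`, strictly increasing on the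
UPPER branch `t ≥ t*` (`pocket_logH1_strictAntiOn`, `…MonoOn`, `pocket_logH2_…`), restated as strict product inequalities between two
parameters (`pocket_H1_lt_lower/upper`, `pocket_H2_lt_lower/upper`) — the numeric side of the pocket rows of file IV.

[folklore] One-variable calculus; elementary.
-/

-- `Summit.ValiantsHypothesis.ValiantsHypothesis.…` repeats a component by the D-0017 layout
-- (single-conjunct summit), which the `dupNamespace` linter flags; the name is mandated.
set_option linter.dupNamespace false

namespace Summit.ValiantsHypothesis.ValiantsHypothesis.Theorems.LacunarySymmetroidMatrixDescartes.Census

open Polynomial Finset Set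
open scoped BigOperators Polynomial

/-! ## The double-root curve in the parameter `t = e·ρ^S/a`: monotonicity of its two circuit coordinates

Along the curve of window 4-nomials with a positive DOUBLE root `ρ`, put `t = e·ρ^S/a` (`S = u+v+w`).  Then
`Σ1 := b^(u+v)/(a^v c^u) = H1(t) := ((u+v)+w·t)^(u+v) / (v^v·(u+(v+w)t)^u)` and
`Σ2 := c^(v+w)/(b^w e^v) = H2(t) := (u+(v+w)t)^(v+w) / (v^v·((u+v)+w·t)^w·t^v)`;
both `log H1` and `log H2` have `t`-derivative `v·(w(v+w)t − u(u+v))/(positive)`, so both are strictly decreasing on the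
LOWER branch `t ≤ t* := u(u+v)/(w(v+w))` and strictly increasing on the UPPER branch `t ≥ t*` (the cusp is `t = t*`). -/

/-- Derivative of `t ↦ log (p + q·t)` at a point where `p + q·t > 0`. [folklore] -/
theorem hasDerivAt_log_affine {p q t : ℝ} (h : 0 < p + q * t) :
    HasDerivAt (fun t : ℝ => Real.log (p + q * t)) (q / (p + q * t)) t := by
  have h1 : HasDerivAt (fun t : ℝ => p + q * t) q t := by
    simpa using ((hasDerivAt_id t).const_mul q).const_add p
  have h2 := (Real.hasDerivAt_log h.ne').comp t h1
  refine h2.congr_deriv ?_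
  rw [inv_mul_eq_div]

/-- **`log H1` is strictly decreasing on the lower branch `[0, t*]`.** [folklore] -/
theorem pocket_logH1_strictAntiOn {u v w : ℕ} (hu : 0 < u) (hv : 0 < v) (hw : 0 < w) :
    StrictAntiOn (fun t : ℝ => ((u : ℝ) + v) * Real.log (((u : ℝ) + v) + (w : ℝ) * t)
        - (u : ℝ) * Real.log ((u : ℝ) + ((v : ℝ) + w) * t))
      (Icc 0 ((u : ℝ) * ((u : ℝ) + v) / ((w : ℝ) * ((v : ℝ) + w)))) := by
  set T : ℝ := (u : ℝ) * ((u : ℝ) + v) / ((w : ℝ) * ((v : ℝ) + w)) with hT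
  apply strictAntiOn_of_deriv_neg (convex_Icc 0 T)
  · apply ContinuousOn.sub
    · refine continuousOn_const.mul (ContinuousOn.log (by fun_prop) ?_)
      intro t ht; have : (0 : ℝ) ≤ t := ht.1; positivity
    · refine continuousOn_const.mul (ContinuousOn.log (by fun_prop) ?_)
      intro t ht; have : (0 : ℝ) ≤ t := ht.1; positivity
  · intro t ht
    rw [interior_Icc] at ht
    have ht0 : 0 < t := ht.1
    have hA : 0 < ((u : ℝ) + v) + (w : ℝ) * t := by positivity
    have hB : 0 < (u : ℝ) + ((v : ℝ) + w) * t := by positivity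
    have hd : HasDerivAt (fun t : ℝ => ((u : ℝ) + v) * Real.log (((u : ℝ) + v) + (w : ℝ) * t)
        - (u : ℝ) * Real.log ((u : ℝ) + ((v : ℝ) + w) * t))
        (((u : ℝ) + v) * ((w : ℝ) / (((u : ℝ) + v) + (w : ℝ) * t))
          - (u : ℝ) * ((((v : ℝ) + w)) / ((u : ℝ) + ((v : ℝ) + w) * t))) t :=
      ((hasDerivAt_log_affine hA).const_mul _).sub ((hasDerivAt_log_affine hB).const_mul _)
    rw [hd.deriv]
    have htT : (w : ℝ) * ((v : ℝ) + w) * t < (u : ℝ) * ((u : ℝ) + v) := by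
      have h := ht.2; rw [hT, lt_div_iff₀ (by positivity)] at h; linarith
    rw [sub_neg, mul_div_assoc', mul_div_assoc', div_lt_div_iff₀ hA hB]
    have hv0 : (0 : ℝ) < v := by exact_mod_cast hv
    nlinarith [mul_lt_mul_of_pos_left htT hv0]

/-- **`log H1` is strictly increasing on the upper branch `[t*, ∞)`.** [folklore] -/
theorem pocket_logH1_strictMonoOn {u v w : ℕ} (hu : 0 < u) (hv : 0 < v) (hw : 0 < w) :
    StrictMonoOn (fun t : ℝ => ((u : ℝ) + v) * Real.log (((u : ℝ) + v) + (w : ℝ) * t)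
        - (u : ℝ) * Real.log ((u : ℝ) + ((v : ℝ) + w) * t))
      (Ici ((u : ℝ) * ((u : ℝ) + v) / ((w : ℝ) * ((v : ℝ) + w)))) := by
  set T : ℝ := (u : ℝ) * ((u : ℝ) + v) / ((w : ℝ) * ((v : ℝ) + w)) with hT
  have hT0 : 0 < T := by rw [hT]; positivity
  apply strictMonoOn_of_deriv_pos (convex_Ici T)
  · apply ContinuousOn.sub
    · refine continuousOn_const.mul (ContinuousOn.log (by fun_prop) ?_)
      intro t ht; have : (0 : ℝ) ≤ t := hT0.le.trans ht; positivity
    · refine continuousOn_const.mul (ContinuousOn.log (by fun_prop) ?_)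
      intro t ht; have : (0 : ℝ) ≤ t := hT0.le.trans ht; positivity
  · intro t ht
    rw [interior_Ici] at ht
    have hTt : T < t := ht
    have ht0 : 0 < t := hT0.trans hTt
    have hA : 0 < ((u : ℝ) + v) + (w : ℝ) * t := by positivity
    have hB : 0 < (u : ℝ) + ((v : ℝ) + w) * t := by positivity
    have hd : HasDerivAt (fun t : ℝ => ((u : ℝ) + v) * Real.log (((u : ℝ) + v) + (w : ℝ) * t)
        - (u : ℝ) * Real.log ((u : ℝ) + ((v : ℝ) + w) * t))
        (((u : ℝ) + v) * ((w : ℝ) / (((u : ℝ) + v) + (w : ℝ) * t))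
          - (u : ℝ) * ((((v : ℝ) + w)) / ((u : ℝ) + ((v : ℝ) + w) * t))) t :=
      ((hasDerivAt_log_affine hA).const_mul _).sub ((hasDerivAt_log_affine hB).const_mul _)
    rw [hd.deriv]
    have htT : (u : ℝ) * ((u : ℝ) + v) < (w : ℝ) * ((v : ℝ) + w) * t := by
      have h := hTt; rw [hT, div_lt_iff₀ (by positivity)] at h; linarith
    rw [sub_pos, mul_div_assoc', mul_div_assoc', div_lt_div_iff₀ hB hA]
    have hv0 : (0 : ℝ) < v := by exact_mod_cast hv
    nlinarith [mul_lt_mul_of_pos_left htT hv0]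

/-- **`log H2` is strictly decreasing on the lower branch `(0, t*]`.** [folklore] -/
theorem pocket_logH2_strictAntiOn {u v w : ℕ} (hu : 0 < u) (hv : 0 < v) (hw : 0 < w) :
    StrictAntiOn (fun t : ℝ => ((v : ℝ) + w) * Real.log ((u : ℝ) + ((v : ℝ) + w) * t)
        - (w : ℝ) * Real.log (((u : ℝ) + v) + (w : ℝ) * t) - (v : ℝ) * Real.log t)
      (Ioc 0 ((u : ℝ) * ((u : ℝ) + v) / ((w : ℝ) * ((v : ℝ) + w)))) := by
  set T : ℝ := (u : ℝ) * ((u : ℝ) + v) / ((w : ℝ) * ((v : ℝ) + w)) with hT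
  apply strictAntiOn_of_deriv_neg (convex_Ioc 0 T)
  · apply ContinuousOn.sub
    · apply ContinuousOn.sub
      · refine continuousOn_const.mul (ContinuousOn.log (by fun_prop) ?_)
        intro t ht; have : (0 : ℝ) < t := ht.1; positivity
      · refine continuousOn_const.mul (ContinuousOn.log (by fun_prop) ?_)
        intro t ht; have : (0 : ℝ) < t := ht.1; positivity
    · refine continuousOn_const.mul (ContinuousOn.log (by fun_prop) ?_)
      intro t ht; exact ht.1.ne'
  · intro t ht
    rw [interior_Ioc] at ht
    have ht0 : 0 < t := ht.1
    have hA : 0 < ((u : ℝ) + v) + (w : ℝ) * t := by positivity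
    have hB : 0 < (u : ℝ) + ((v : ℝ) + w) * t := by positivity
    have hd : HasDerivAt (fun t : ℝ => ((v : ℝ) + w) * Real.log ((u : ℝ) + ((v : ℝ) + w) * t)
        - (w : ℝ) * Real.log (((u : ℝ) + v) + (w : ℝ) * t) - (v : ℝ) * Real.log t)
        (((v : ℝ) + w) * ((((v : ℝ) + w)) / ((u : ℝ) + ((v : ℝ) + w) * t))
          - (w : ℝ) * ((w : ℝ) / (((u : ℝ) + v) + (w : ℝ) * t)) - (v : ℝ) * t⁻¹) t :=
      (((hasDerivAt_log_affine hB).const_mul _).sub ((hasDerivAt_log_affine hA).const_mul _)).sub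
        ((Real.hasDerivAt_log ht0.ne').const_mul _)
    rw [hd.deriv]
    have htT : (w : ℝ) * ((v : ℝ) + w) * t < (u : ℝ) * ((u : ℝ) + v) := by
      have h := ht.2; rw [hT, lt_div_iff₀ (by positivity)] at h; linarith
    have hA' := hA.ne'; have hB' := hB.ne'; have ht0' := ht0.ne'
    have hid : ((v : ℝ) + w) * ((((v : ℝ) + w)) / ((u : ℝ) + ((v : ℝ) + w) * t))
          - (w : ℝ) * ((w : ℝ) / (((u : ℝ) + v) + (w : ℝ) * t)) - (v : ℝ) * t⁻¹
        = (v : ℝ) * ((w : ℝ) * ((v : ℝ) + w) * t - (u : ℝ) * ((u : ℝ) + v))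
          / (t * (((u : ℝ) + v) + (w : ℝ) * t) * ((u : ℝ) + ((v : ℝ) + w) * t)) := by
      field_simp
      ring
    rw [hid]
    have hv0 : (0 : ℝ) < v := by exact_mod_cast hv
    exact div_neg_of_neg_of_pos (mul_neg_of_pos_of_neg hv0 (by linarith)) (by positivity)

/-- **`log H2` is strictly increasing on the upper branch `[t*, ∞)`.** [folklore] -/
theorem pocket_logH2_strictMonoOn {u v w : ℕ} (hu : 0 < u) (hv : 0 < v) (hw : 0 < w) :
    StrictMonoOn (fun t : ℝ => ((v : ℝ) + w) * Real.log ((u : ℝ) + ((v : ℝ) + w) * t)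
        - (w : ℝ) * Real.log (((u : ℝ) + v) + (w : ℝ) * t) - (v : ℝ) * Real.log t)
      (Ici ((u : ℝ) * ((u : ℝ) + v) / ((w : ℝ) * ((v : ℝ) + w)))) := by
  set T : ℝ := (u : ℝ) * ((u : ℝ) + v) / ((w : ℝ) * ((v : ℝ) + w)) with hT
  have hT0 : 0 < T := by rw [hT]; positivity
  apply strictMonoOn_of_deriv_pos (convex_Ici T)
  · apply ContinuousOn.sub
    · apply ContinuousOn.sub
      · refine continuousOn_const.mul (ContinuousOn.log (by fun_prop) ?_)
        intro t ht; have : (0 : ℝ) ≤ t := hT0.le.trans ht; positivity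
      · refine continuousOn_const.mul (ContinuousOn.log (by fun_prop) ?_)
        intro t ht; have : (0 : ℝ) ≤ t := hT0.le.trans ht; positivity
    · refine continuousOn_const.mul (ContinuousOn.log (by fun_prop) ?_)
      intro t ht; exact (hT0.trans_le ht).ne'
  · intro t ht
    rw [interior_Ici] at ht
    have hTt : T < t := ht
    have ht0 : 0 < t := hT0.trans hTt
    have hA : 0 < ((u : ℝ) + v) + (w : ℝ) * t := by positivity
    have hB : 0 < (u : ℝ) + ((v : ℝ) + w) * t := by positivity
    have hd : HasDerivAt (fun t : ℝ => ((v : ℝ) + w) * Real.log ((u : ℝ) + ((v : ℝ) + w) * t)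
        - (w : ℝ) * Real.log (((u : ℝ) + v) + (w : ℝ) * t) - (v : ℝ) * Real.log t)
        (((v : ℝ) + w) * ((((v : ℝ) + w)) / ((u : ℝ) + ((v : ℝ) + w) * t))
          - (w : ℝ) * ((w : ℝ) / (((u : ℝ) + v) + (w : ℝ) * t)) - (v : ℝ) * t⁻¹) t :=
      (((hasDerivAt_log_affine hB).const_mul _).sub ((hasDerivAt_log_affine hA).const_mul _)).sub
        ((Real.hasDerivAt_log ht0.ne').const_mul _)
    rw [hd.deriv]
    have htT : (u : ℝ) * ((u : ℝ) + v) < (w : ℝ) * ((v : ℝ) + w) * t := by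
      have h := hTt; rw [hT, div_lt_iff₀ (by positivity)] at h; linarith
    have hA' := hA.ne'; have hB' := hB.ne'; have ht0' := ht0.ne'
    have hid : ((v : ℝ) + w) * ((((v : ℝ) + w)) / ((u : ℝ) + ((v : ℝ) + w) * t))
          - (w : ℝ) * ((w : ℝ) / (((u : ℝ) + v) + (w : ℝ) * t)) - (v : ℝ) * t⁻¹
        = (v : ℝ) * ((w : ℝ) * ((v : ℝ) + w) * t - (u : ℝ) * ((u : ℝ) + v))
          / (t * (((u : ℝ) + v) + (w : ℝ) * t) * ((u : ℝ) + ((v : ℝ) + w) * t)) := by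
      field_simp
      ring
    rw [hid]
    have hv0 : (0 : ℝ) < v := by exact_mod_cast hv
    exact div_pos (mul_pos hv0 (by linarith)) (by positivity)

/-- `log` comparison ⇒ product comparison: `m·log x₁ + k·log y₁ < m·log x₂ + k·log y₂ ⇒ x₁^m y₁^k < x₂^m y₂^k`. [folklore] -/
theorem pow_mul_pow_lt_of_log_lt {x₁ y₁ x₂ y₂ : ℝ} (hx₁ : 0 < x₁) (hy₁ : 0 < y₁) (hx₂ : 0 < x₂) (hy₂ : 0 < y₂) (m k : ℕ)
    (h : (m : ℝ) * Real.log x₁ + (k : ℝ) * Real.log y₁ < (m : ℝ) * Real.log x₂ + (k : ℝ) * Real.log y₂) :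
    x₁ ^ m * y₁ ^ k < x₂ ^ m * y₂ ^ k := by
  have h1 : Real.log (x₁ ^ m * y₁ ^ k) = (m : ℝ) * Real.log x₁ + (k : ℝ) * Real.log y₁ := by
    rw [Real.log_mul (pow_pos hx₁ m).ne' (pow_pos hy₁ k).ne', Real.log_pow, Real.log_pow]
  have h2 : Real.log (x₂ ^ m * y₂ ^ k) = (m : ℝ) * Real.log x₂ + (k : ℝ) * Real.log y₂ := by
    rw [Real.log_mul (pow_pos hx₂ m).ne' (pow_pos hy₂ k).ne', Real.log_pow, Real.log_pow]
  have : Real.log (x₁ ^ m * y₁ ^ k) < Real.log (x₂ ^ m * y₂ ^ k) := by rw [h1, h2]; exact h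
  exact (Real.log_lt_log_iff (by positivity) (by positivity)).mp this

/-- **`H1` on the lower branch**: `0 < t₁ < t₂ ≤ t*` ⇒ `H1(t₂) < H1(t₁)`, as the product inequality
`((u+v)+w·t₂)^(u+v)·(u+(v+w)t₁)^u < ((u+v)+w·t₁)^(u+v)·(u+(v+w)t₂)^u`. [folklore] -/
theorem pocket_H1_lt_lower {u v w : ℕ} (hu : 0 < u) (hv : 0 < v) (hw : 0 < w) {t₁ t₂ : ℝ} (ht₁ : 0 < t₁)
    (h12 : t₁ < t₂) (ht₂ : (w : ℝ) * ((v : ℝ) + w) * t₂ ≤ (u : ℝ) * ((u : ℝ) + v)) :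
    (((u : ℝ) + v) + (w : ℝ) * t₂) ^ (u + v) * ((u : ℝ) + ((v : ℝ) + w) * t₁) ^ u
      < (((u : ℝ) + v) + (w : ℝ) * t₁) ^ (u + v) * ((u : ℝ) + ((v : ℝ) + w) * t₂) ^ u := by
  have hT₂ : t₂ ≤ (u : ℝ) * ((u : ℝ) + v) / ((w : ℝ) * ((v : ℝ) + w)) := by
    rw [le_div_iff₀ (by positivity)]; linarith
  have ht₂0 : 0 < t₂ := ht₁.trans h12
  have h := pocket_logH1_strictAntiOn hu hv hw ⟨ht₁.le, h12.le.trans hT₂⟩ ⟨ht₂0.le, hT₂⟩ h12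
  have h' : ((u : ℝ) + v) * Real.log (((u : ℝ) + v) + (w : ℝ) * t₂) - (u : ℝ) * Real.log ((u : ℝ) + ((v : ℝ) + w) * t₂)
      < ((u : ℝ) + v) * Real.log (((u : ℝ) + v) + (w : ℝ) * t₁) - (u : ℝ) * Real.log ((u : ℝ) + ((v : ℝ) + w) * t₁) := h
  refine pow_mul_pow_lt_of_log_lt (by positivity) (by positivity) (by positivity) (by positivity) (u + v) u ?_
  push_cast; linarith

/-- **`H1` on the upper branch**: `t* ≤ t₁ < t₂` ⇒ `H1(t₁) < H1(t₂)`. [folklore] -/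
theorem pocket_H1_lt_upper {u v w : ℕ} (hu : 0 < u) (hv : 0 < v) (hw : 0 < w) {t₁ t₂ : ℝ}
    (ht₁ : (u : ℝ) * ((u : ℝ) + v) ≤ (w : ℝ) * ((v : ℝ) + w) * t₁) (h12 : t₁ < t₂) :
    (((u : ℝ) + v) + (w : ℝ) * t₁) ^ (u + v) * ((u : ℝ) + ((v : ℝ) + w) * t₂) ^ u
      < (((u : ℝ) + v) + (w : ℝ) * t₂) ^ (u + v) * ((u : ℝ) + ((v : ℝ) + w) * t₁) ^ u := by
  have hT₁ : (u : ℝ) * ((u : ℝ) + v) / ((w : ℝ) * ((v : ℝ) + w)) ≤ t₁ := by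
    rw [div_le_iff₀ (by positivity)]; linarith
  have ht₁0 : 0 < t₁ := lt_of_lt_of_le (by positivity) hT₁
  have ht₂0 : 0 < t₂ := ht₁0.trans h12
  have h := pocket_logH1_strictMonoOn hu hv hw hT₁ (hT₁.trans h12.le) h12
  have h' : ((u : ℝ) + v) * Real.log (((u : ℝ) + v) + (w : ℝ) * t₁) - (u : ℝ) * Real.log ((u : ℝ) + ((v : ℝ) + w) * t₁)
      < ((u : ℝ) + v) * Real.log (((u : ℝ) + v) + (w : ℝ) * t₂) - (u : ℝ) * Real.log ((u : ℝ) + ((v : ℝ) + w) * t₂) := h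
  refine pow_mul_pow_lt_of_log_lt (by positivity) (by positivity) (by positivity) (by positivity) (u + v) u ?_
  push_cast; linarith

/-- **`H2` on the lower branch**: `0 < t₁ < t₂ ≤ t*` ⇒ `H2(t₂) < H2(t₁)`, as the product inequality
`(u+(v+w)t₂)^(v+w)·(((u+v)+w·t₁)^w·t₁^v) < (u+(v+w)t₁)^(v+w)·(((u+v)+w·t₂)^w·t₂^v)`. [folklore] -/
theorem pocket_H2_lt_lower {u v w : ℕ} (hu : 0 < u) (hv : 0 < v) (hw : 0 < w) {t₁ t₂ : ℝ} (ht₁ : 0 < t₁)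
    (h12 : t₁ < t₂) (ht₂ : (w : ℝ) * ((v : ℝ) + w) * t₂ ≤ (u : ℝ) * ((u : ℝ) + v)) :
    ((u : ℝ) + ((v : ℝ) + w) * t₂) ^ (v + w) * ((((u : ℝ) + v) + (w : ℝ) * t₁) ^ w * t₁ ^ v)
      < ((u : ℝ) + ((v : ℝ) + w) * t₁) ^ (v + w) * ((((u : ℝ) + v) + (w : ℝ) * t₂) ^ w * t₂ ^ v) := by
  have hT₂ : t₂ ≤ (u : ℝ) * ((u : ℝ) + v) / ((w : ℝ) * ((v : ℝ) + w)) := by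
    rw [le_div_iff₀ (by positivity)]; linarith
  have ht₂0 : 0 < t₂ := ht₁.trans h12
  have h := pocket_logH2_strictAntiOn hu hv hw ⟨ht₁, h12.le.trans hT₂⟩ ⟨ht₂0, hT₂⟩ h12
  have h' : ((v : ℝ) + w) * Real.log ((u : ℝ) + ((v : ℝ) + w) * t₂)
        - (w : ℝ) * Real.log (((u : ℝ) + v) + (w : ℝ) * t₂) - (v : ℝ) * Real.log t₂
      < ((v : ℝ) + w) * Real.log ((u : ℝ) + ((v : ℝ) + w) * t₁)
        - (w : ℝ) * Real.log (((u : ℝ) + v) + (w : ℝ) * t₁) - (v : ℝ) * Real.log t₁ := h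
  have hlt : Real.log (((u : ℝ) + ((v : ℝ) + w) * t₂) ^ (v + w) * ((((u : ℝ) + v) + (w : ℝ) * t₁) ^ w * t₁ ^ v))
      < Real.log (((u : ℝ) + ((v : ℝ) + w) * t₁) ^ (v + w) * ((((u : ℝ) + v) + (w : ℝ) * t₂) ^ w * t₂ ^ v)) := by
    rw [Real.log_mul (by positivity) (by positivity), Real.log_mul (by positivity) (by positivity),
      Real.log_mul (by positivity) (by positivity), Real.log_mul (by positivity) (by positivity),
      Real.log_pow, Real.log_pow, Real.log_pow, Real.log_pow, Real.log_pow, Real.log_pow]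
    push_cast; linarith
  exact (Real.log_lt_log_iff (by positivity) (by positivity)).mp hlt

/-- **`H2` on the upper branch**: `t* ≤ t₁ < t₂` ⇒ `H2(t₁) < H2(t₂)`. [folklore] -/
theorem pocket_H2_lt_upper {u v w : ℕ} (hu : 0 < u) (hv : 0 < v) (hw : 0 < w) {t₁ t₂ : ℝ}
    (ht₁ : (u : ℝ) * ((u : ℝ) + v) ≤ (w : ℝ) * ((v : ℝ) + w) * t₁) (h12 : t₁ < t₂) :
    ((u : ℝ) + ((v : ℝ) + w) * t₁) ^ (v + w) * ((((u : ℝ) + v) + (w : ℝ) * t₂) ^ w * t₂ ^ v)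
      < ((u : ℝ) + ((v : ℝ) + w) * t₂) ^ (v + w) * ((((u : ℝ) + v) + (w : ℝ) * t₁) ^ w * t₁ ^ v) := by
  have hT₁ : (u : ℝ) * ((u : ℝ) + v) / ((w : ℝ) * ((v : ℝ) + w)) ≤ t₁ := by
    rw [div_le_iff₀ (by positivity)]; linarith
  have ht₁0 : 0 < t₁ := lt_of_lt_of_le (by positivity) hT₁
  have ht₂0 : 0 < t₂ := ht₁0.trans h12
  have h := pocket_logH2_strictMonoOn hu hv hw hT₁ (hT₁.trans h12.le) h12
  have h' : ((v : ℝ) + w) * Real.log ((u : ℝ) + ((v : ℝ) + w) * t₁)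
        - (w : ℝ) * Real.log (((u : ℝ) + v) + (w : ℝ) * t₁) - (v : ℝ) * Real.log t₁
      < ((v : ℝ) + w) * Real.log ((u : ℝ) + ((v : ℝ) + w) * t₂)
        - (w : ℝ) * Real.log (((u : ℝ) + v) + (w : ℝ) * t₂) - (v : ℝ) * Real.log t₂ := h
  have hlt : Real.log (((u : ℝ) + ((v : ℝ) + w) * t₁) ^ (v + w) * ((((u : ℝ) + v) + (w : ℝ) * t₂) ^ w * t₂ ^ v))
      < Real.log (((u : ℝ) + ((v : ℝ) + w) * t₂) ^ (v + w) * ((((u : ℝ) + v) + (w : ℝ) * t₁) ^ w * t₁ ^ v)) := by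
    rw [Real.log_mul (by positivity) (by positivity), Real.log_mul (by positivity) (by positivity),
      Real.log_mul (by positivity) (by positivity), Real.log_mul (by positivity) (by positivity),
      Real.log_pow, Real.log_pow, Real.log_pow, Real.log_pow, Real.log_pow, Real.log_pow]
    push_cast; linarith
  exact (Real.log_lt_log_iff (by positivity) (by positivity)).mp hlt

end Summit.ValiantsHypothesis.ValiantsHypothesis.Theorems.LacunarySymmetroidMatrixDescartes.Census
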